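import Summits.Ventures.PercRepro.S1NineSixRankSevenEleven

/-!
# PercRepro — THE DOWNWARD EXTENSION INCIDENCE: LOW-RANK `(k + 1)`-SETS AGAINST THEIR `k`-SUBSETS (p2, gen 28;
SUBCLAIM-S1 §6.10 (xvii)(q))

The incidence of `S1LowRankExtension` read from the other side: every `(k + 1)`-set `P` of rank `≤ b` has `k + 1`
subsets of size `k`, all of rank `≤ b`, and every `k`-set has at most `n − k` supersets of size `k + 1`; hence
`(k + 1) · #{(k + 1)-sets of rank ≤ b} ≤ (n − k) · #{k-sets of rank ≤ b}` («a big low-rank set forces many small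
low-rank sets»). Nothing is claimed about any cell.

* `subsetPairs`; **`add_one_mul_ncard_lowRankSets_le`**.
Axioms: standard.
-/

open scoped Matroid

namespace PercRepro

namespace S1

open Set

variable {α : Type}

/-- The incidences «a `k`-subset of a low-rank `(k + 1)`-set». -/
def subsetPairs (M : Matroid α) (k b : ℕ) : Set (Set α × Set α) :=
  {R : Set α × Set α | R.1 ∈ lowRankSets M (k + 1) b ∧ R.2 ⊆ R.1 ∧ R.2.ncard = k}

/-- The incidences are finite. -/
theorem subsetPairs_finite (M : Matroid α) [M.Finite] (k b : ℕ) : (subsetPairs M k b).Finite :=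
  (M.ground_finite.finite_subsets.prod M.ground_finite.finite_subsets).subset
    (fun _ hR => ⟨hR.1.1, hR.2.1.trans hR.1.1⟩)

/-- **THE DOWNWARD INCIDENCE**: `(k + 1) · #((k + 1)-sets of rank ≤ b) ≤ (n − k) · #(k-sets of rank ≤ b)`. -/
theorem add_one_mul_ncard_lowRankSets_le (M : Matroid α) [M.Finite] (k b : ℕ) :
    (k + 1) * (lowRankSets M (k + 1) b).ncard ≤ (M.E.ncard - k) * (lowRankSets M k b).ncard := by
  have hLfin := lowRankSets_finite M (k + 1) b
  have hKfin := lowRankSets_finite M k b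
  have hIfin := subsetPairs_finite M k b
  -- lower side: each low-rank `(k + 1)`-set has `k + 1` subsets of size `k`
  have heq : subsetPairs M k b = ⋃ P ∈ lowRankSets M (k + 1) b,
      ({P} ×ˢ {Q : Set α | Q ⊆ P ∧ Q.ncard = k} : Set (Set α × Set α)) := by
    ext ⟨P, Q⟩
    simp only [subsetPairs, mem_setOf_eq, mem_iUnion, mem_prod, mem_singleton_iff, exists_prop]
    constructor
    · rintro ⟨hP, hQP, hQ⟩
      exact ⟨P, hP, rfl, hQP, hQ⟩
    · rintro ⟨P', hP', rfl, hQP, hQ⟩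
      exact ⟨hP', hQP, hQ⟩
  have hfib : ∀ P ∈ lowRankSets M (k + 1) b,
      (({P} ×ˢ {Q : Set α | Q ⊆ P ∧ Q.ncard = k} : Set (Set α × Set α))).Finite :=
    fun P hP => (finite_singleton P).prod ((M.ground_finite.subset hP.1).finite_subsets.subset (fun _ hQ => hQ.1))
  have hdisj : (lowRankSets M (k + 1) b).PairwiseDisjoint
      (fun P : Set α => ({P} ×ˢ {Q : Set α | Q ⊆ P ∧ Q.ncard = k} : Set (Set α × Set α))) := by
    intro P _ P' _ hPP
    rw [Function.onFun, Set.disjoint_left]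
    rintro ⟨C, Q⟩ ⟨hC1, -⟩ ⟨hC2, -⟩
    apply hPP
    rw [mem_singleton_iff] at hC1 hC2
    rw [← hC1, ← hC2]
  have hlow : (k + 1) * (lowRankSets M (k + 1) b).ncard = (subsetPairs M k b).ncard := by
    rw [heq, hLfin.ncard_biUnion hfib hdisj, finsum_mem_eq_finite_toFinset_sum _ hLfin]
    rw [Finset.sum_congr rfl (g := fun _ => k + 1) ?_]
    · rw [Finset.sum_const, smul_eq_mul, ncard_eq_toFinset_card _ hLfin, mul_comm]
    · intro P hP
      rw [Finite.mem_toFinset] at hP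
      rw [ncard_prod, ncard_singleton, one_mul, ncard_setOf_subset_ncard_eq (M.ground_finite.subset hP.1) k, hP.2.1,
        Nat.choose_succ_self_right]
  -- upper side: the incidences lie over the low-rank `k`-sets, at most `n − k` each
  have hup : subsetPairs M k b ⊆ ⋃ Q ∈ lowRankSets M k b, {R ∈ subsetPairs M k b | R.2 = Q} := by
    rintro ⟨P, Q⟩ ⟨hP, hQP, hQ⟩
    rw [mem_iUnion₂]
    refine ⟨Q, ⟨hQP.trans hP.1, hQ, (M.eRk_mono hQP).trans hP.2.2⟩, ⟨hP, hQP, hQ⟩, rfl⟩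
  have hfibQ : ∀ Q ∈ lowRankSets M k b, {R ∈ subsetPairs M k b | R.2 = Q}.ncard ≤ M.E.ncard - k := by
    rintro Q ⟨hQE, hQk, -⟩
    have hQfin : Q.Finite := M.ground_finite.subset hQE
    have hsub : {R ∈ subsetPairs M k b | R.2 = Q} ⊆ (fun x => (insert x Q, Q)) '' (M.E \ Q) := by
      rintro ⟨P, Q'⟩ ⟨⟨hP, hQP, -⟩, hQQ⟩
      have hQQ' : Q = Q' := (hQQ : Q' = Q).symm
      subst hQQ'
      have h1 : (P \ Q).ncard = 1 := by rw [ncard_sdiff' hQP (M.ground_finite.subset hP.1), hP.2.1, hQk]; omega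
      obtain ⟨x, hx⟩ := ncard_eq_one.mp h1
      have hxmem : x ∈ P \ Q := by rw [hx]; exact mem_singleton x
      refine ⟨x, ⟨hP.1 hxmem.1, hxmem.2⟩, ?_⟩
      simp only [Prod.mk.injEq, and_true]
      ext w
      constructor
      · rintro (rfl | hw)
        · exact hxmem.1
        · exact hQP hw
      · intro hw
        by_cases hwQ : w ∈ Q
        · exact Or.inr hwQ
        · have : w ∈ P \ Q := ⟨hw, hwQ⟩
          rw [hx] at this
          exact Or.inl this
    have hfin' : (M.E \ Q).Finite := M.ground_finite.subset sdiff_subset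
    refine (ncard_le_ncard hsub (hfin'.image _)).trans ((ncard_image_le hfin').trans ?_)
    rw [ncard_sdiff' hQE M.ground_finite, hQk]
  calc (k + 1) * (lowRankSets M (k + 1) b).ncard = (subsetPairs M k b).ncard := hlow
    _ ≤ (⋃ Q ∈ lowRankSets M k b, {R ∈ subsetPairs M k b | R.2 = Q}).ncard :=
        ncard_le_ncard hup (hKfin.biUnion (fun Q _ => hIfin.subset (fun R hR => hR.1)))
    _ ≤ ∑ᶠ Q ∈ lowRankSets M k b, {R ∈ subsetPairs M k b | R.2 = Q}.ncard := hKfin.ncard_biUnion_le _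
    _ = ∑ Q ∈ hKfin.toFinset, {R ∈ subsetPairs M k b | R.2 = Q}.ncard := finsum_mem_eq_finite_toFinset_sum _ hKfin
    _ ≤ hKfin.toFinset.card • (M.E.ncard - k) := by
        apply Finset.sum_le_card_nsmul
        intro Q hQ
        rw [Finite.mem_toFinset] at hQ
        exact hfibQ Q hQ
    _ = (M.E.ncard - k) * (lowRankSets M k b).ncard := by
        rw [smul_eq_mul, ← ncard_eq_toFinset_card _ hKfin, mul_comm]

end S1

end PercRepro
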